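import Literature.Probability.Percolation.TransversalReroute
import Literature.Probability.Percolation.TrapTermFence
import Literature.Probability.Percolation.TriLowestCrossingPairs
import HarnessLib

/-!
# Attaching the fence of a term to a rerouted member; fence zones are never invaded

Topic: Probability / Percolation; family `crit-perc` (site percolation on the triangular lattice
`𝕋 = triGraph`). A brick of the generic (any-multiplicity) same-colour step of Nolin's
arm-separation theorem (Nolin 2008, Thm. 11, §4.4 Lemma 15 [arXiv 0711.4948: Thm. 10, Lemma 14];
organised after Kesten–Sidoravicius–Zhang 1998, App. §7) towards
`Literature.Probability.Percolation.Nolin2008_prop17_quasiMult` (`FiveArmExponentFacts.lean`).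

Setting: the trapezoid `trapDomain M` behind side `0` of `∂Λ_{2M}`, a configuration `ω` (open =
the colour being separated), a closed transversal `τ` of `ω` (`TransversalReroute.lean`), the
`u`-th term `c` of the exploration sequence with tip `z` (`8k`-middle), raw-good at scale `k`
(`TrapRawOK`, `ArmSeparationRawGood.lean`: a fence at scale `k`, the two exclusion rings), and a
fence `Tf : TermFence M c z k ω ↑c` of `c` STOPPED AT THE TERM ITSELF (`TrapTermFence.lean`).
Members of the family being rerouted are open `𝕋`-connected sets of sites of `Λ_{2M}` containing a
start in `Λ_M`; the member rerouted onto the term `u` is `τ.reroute A a` with `τ.firstTerm A a = u`.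

## Main results

* `JDomain.Transversal.not_mem_T_near_tip` — no open site of `above c z` in the `17k`-box about
  `z` lies on the transversal (it would be the junction of a later term, an open crossing off
  `lower c z` from the `17k`-box to `trapI`: outer ring).
* `JDomain.Transversal.isRight_of_mem_termFence` — the inside sites of the connection `Tf.F` lie
  right of `τ` (follow the connection out of `Λ_{2M}`: it leaves through the outer side near `z`).
* `JDomain.Transversal.termFence_q_mem_reroute` — **attachment**: the attachment site `Tf.q ∈ c`
  lies in the rerouted member (it is right of `τ`, or the junction, or the tip).
* `JDomain.Transversal.not_mem_reroute_of_mem_termFence` — the connection misses its own member.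
* `JDomain.Transversal.not_mem_of_mem_termFence` — **no invasion**: the connection misses every
  open `𝕋`-connected set of sites of `Λ_{2M}` started in `Λ_M` and disjoint from the rerouted
  member — in particular every other member of the final family, of this or of any other frame
  processed earlier or later (Nolin 2008, proof of Lemma 15: "this extension is connected by a
  path that touches `c_{v_1}` in, say, `b_1`: either `b_1` is between `a_1` and `z_1` … otherwise
  `c'_1` has to cross the connecting path before `a_1`" — here: a foreign member through a fence
  site, followed home, must enter `lower c z` inside the `7k`-box (inner ring) at a site of `c`
  right of `τ`, ie at a site of the member owning `c`).
* `termFence_disjoint_of_lt`, `termFence_not_mem_term` — fences of two terms of one frame are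
  disjoint (the higher tip is `> 17k` rows up), and a fence misses the other terms.
* `JDomain.lowestSeq_subset_below_of_lt` — earlier terms lie below later ones.

## References

* P. Nolin, *Near-critical percolation in two dimensions*, Electron. J. Probab. 13 (2008), §4.4,
  Lemma 15 (proof) [arXiv 0711.4948: Lemma 14]. [Nolin2008]
* H. Kesten, V. Sidoravicius, Y. Zhang, *Almost all words are seen in critical site percolation
  on the triangular lattice*, Electron. J. Probab. 3 (1998), paper 10, App. §7 p. 27.
  [KestenSidoraviciusZhang1998]
* H. Kesten, *Scaling relations for 2D-percolation*, Comm. Math. Phys. 109 (1987), Lemma 2–4.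
  [Kesten1987]

Tree: `TermFence`, `fenceSet`, `TermFence.exists_exit`, `TermFence.not_mem_above_of_row_lt`,
`TermFence.not_mem_of_offLower`, `TrapRawOK.inner_ring`, `TrapRawOK.not_box17_of_offLower`,
`TrapRawOK.row_gap` (`TrapTermFence.lean`, `ArmSeparationRawGood.lean`); `JDomain.Transversal` and
its `reroute` API (`TransversalReroute.lean`); `lowestSeq_subset_above_of_lt`,
`ht_lowestSeq_lt_of_lt` (`TriLowestCrossingPairs.lean`); `triNorm_eq_iff_mem_sides`,
`triNorm_eq_of_adj_exterior`, `trapO_coord`, `triGraph_adj_coord`.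
-/

noncomputable section

namespace Literature.Probability.Percolation

open LatticeModels

namespace JDomain

variable {Q : JDomain} {ω : Set (Site 2)}

/-- **Earlier terms lie below later ones.** [cite: Nolin2008, §4.4 (arXiv 0711.4948: proof of Lemma 14)] -/
theorem lowestSeq_subset_below_of_lt (hcut : Q.CutProp) {u v : ℕ} {c c' : Finset (Site 2)} {z z' : Site 2}
    (huv : u < v) (hu : Q.lowestSeq ω u = some (c, z)) (hv : Q.lowestSeq ω v = some (c', z')) :
    c ⊆ Q.below c' z' := by
  intro x hx
  have hxl : x ∈ Q.lower c' z' := lower_subset_lower_of_le hcut huv.le hu hv (mem_lower.2 (Or.inl hx))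
  rcases mem_lower.1 hxl with h | h
  · exact absurd h (Finset.disjoint_left.1 (lowestSeq_disjoint_of_lt hcut huv hu hv) hx)
  · exact h

end JDomain

open JDomain

variable {M k : ℕ} {ω : SiteConfig (Site 2)} {u : ℕ} {c : Finset (Site 2)} {z : Site 2}

namespace JDomain.Transversal

variable (τ : (trapDomain M).Transversal ω)

/-- **No junction near a fenced tip, above its term.** If the `u`-th term `c` (tip `z`) is raw-good
at scale `k` (`31k + 1 ≤ M`), no open site of `above c z` in the `17k`-box about `z` lies on the
transversal: such a site would be the junction of a term meeting `above c z`, ie of a LATER term,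
which is an open crossing off `lower c z` joining the `17k`-box to `trapI` — excluded by the outer
ring. [cite: Nolin2008, §4.4 Lemma 15 (proof) (arXiv 0711.4948: Lemma 14)] -/
theorem not_mem_T_near_tip (hu : (trapDomain M).lowestSeq ω u = some (c, z)) (hraw : TrapRawOK M c z k ω)
    (hk : 1 ≤ k) (hkM : 31 * (k : ℤ) + 1 ≤ M) {v : Site 2} (hva : v ∈ (trapDomain M).above c z) (hvω : v ∈ ω)
    (hbox : z 0 - 17 * k ≤ v 0 ∧ v 0 ≤ z 0 + 17 * k ∧ z 1 - 17 * k ≤ v 1 ∧ v 1 ≤ z 1 + 17 * k) : v ∉ τ.T := by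
  intro hvT
  have hcut := trapDomain_cutProp M
  obtain ⟨w, c', z', hw, hvj⟩ := τ.eq_jn_of_mem _ hvT hvω
  have hjc' : v ∈ c' := hvj ▸ (τ.jn_mem w c' z' hw).1
  rcases lt_trichotomy w u with hlt | rfl | hgt
  · exact (JDomain.mem_below.1 (JDomain.lowestSeq_subset_below_of_lt hcut hlt hw hu hjc')).2.2 hva
  · rw [hu] at hw
    obtain ⟨rfl, rfl⟩ := Prod.mk.inj (Option.some.inj hw)
    exact JDomain.not_mem_of_mem_above hva hjc'
  · have hc := (JDomain.isCrossing_of_lowestSeq hu).1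
    obtain ⟨hc', hc'ω⟩ := JDomain.isCrossing_of_lowestSeq hw
    have habove : c' ⊆ (trapDomain M).above c z := JDomain.lowestSeq_subset_above_of_lt hcut hgt hu hw
    have hoff : ∀ x ∈ c', x ∉ (trapDomain M).lower c z := fun x hx hxl =>
      (JDomain.mem_lower_iff_not_mem_above (hc'.subset hx)).1 hxl (habove hx)
    obtain ⟨f, hfc', hfI⟩ := hc'.exists_start
    have hz := trapO_coord (tip_mem_trapO hc)
    have hf0 := (mem_trapI.1 hfI).2
    have hA : (↑c' : Set (Site 2)) ⊆ ((↑((trapDomain M).lower c z) : Set (Site 2))ᶜ ∩ ω) :=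
      fun x hx => ⟨fun h => hoff x (Finset.mem_coe.1 hx) (Finset.mem_coe.1 h), hc'ω hx⟩
    exact hraw.not_box17_of_offLower hk hA (hc'.conn _ hjc' f hfc') (Or.inl (by omega)) hbox

/-- A boundary site of the trapezoid within `2k + 2` of an `8k`-middle tip lies on the outer side. [folklore] -/
theorem mem_trapO_of_near_tip {x : Site 2} (hxT : x ∈ trapD M) (hxb : triNorm x = 2 * M) (hz : z ∈ trapO M)
    (hz8 : -(2 * (M : ℤ)) + 8 * k < z 1 ∧ z 1 + 8 * k < 0) (hk : 1 ≤ k)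
    (hnear : z 1 - (2 * k + 2) ≤ x 1 ∧ x 1 ≤ z 1 + (2 * k + 2)) : x ∈ trapO M := by
  have hz' := trapO_coord hz
  have hk' : (1 : ℤ) ≤ k := by exact_mod_cast hk
  rcases (triNorm_eq_iff_mem_sides hxT).1 hxb with h | h | h
  · exact h
  · exfalso; have := (mem_trapB.1 h).2; omega
  · exfalso; have := (mem_trapU.1 h).2; have := mem_trapD.1 hxT; omega

/-- **The inside sites of the fence of a fenced term lie right of `τ`.** Let the `u`-th term `c`
(tip `z`, `8k`-middle) be raw-good at scale `k` (`31k + 1 ≤ M`) and let `Tf` be a fence of `c`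
stopped at `c`. Following the connection from an inside site `x` out of `Λ_{2M}`, the last inside
site is a site of the outer side near `z` (a site of `J`), and the stretch runs through open sites
of `above c z` in the `(2k+1)`-box — off `T` (`not_mem_T_near_tip`). [cite: KestenSidoraviciusZhang1998, App. §7 p. 27] -/
theorem isRight_of_mem_termFence (hu : (trapDomain M).lowestSeq ω u = some (c, z)) (hraw : TrapRawOK M c z k ω)
    (hk : 1 ≤ k) (hkM : 31 * (k : ℤ) + 1 ≤ M) (hz8 : -(2 * (M : ℤ)) + 8 * k < z 1 ∧ z 1 + 8 * k < 0)
    (Tf : TermFence M c z k ω ↑c) {x : Site 2} (hx : x ∈ Tf.F) (hxn : triNorm x ≤ 2 * M) : τ.IsRight x := by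
  have hc := (JDomain.isCrossing_of_lowestSeq hu).1
  have hzO := tip_mem_trapO hc
  have hk' : (1 : ℤ) ≤ k := by exact_mod_cast hk
  obtain ⟨x', e, hx'n, hen, -, hadj, hpath⟩ := Tf.exists_exit hk hzO hx hxn
  have hx'F : x' ∈ Tf.F := hpath.right_mem.2
  have hx'T : x' ∈ trapD M := (mem_fenceSet_inside (Tf.F_subset hx'F) hx'n).1
  have hx'b : triNorm x' = 2 * M := triNorm_eq_of_adj_exterior hx'T hen hadj
  have hbx := fenceSet_box (Tf.F_subset hx'F)
  have hx'O : x' ∈ trapO M := mem_trapO_of_near_tip hx'T hx'b hzO hz8 hk ⟨by omega, by omega⟩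
  have hsub : {v | triNorm v ≤ 2 * M} ∩ Tf.F ⊆ ((↑(trapDomain M).D : Set (Site 2)) \ τ.T) := by
    rintro v ⟨hvn, hvF⟩
    have hin := mem_fenceSet_inside (Tf.F_subset hvF) hvn
    have hvb := fenceSet_box (Tf.F_subset hvF)
    refine ⟨?_, τ.not_mem_T_near_tip hu hraw hk hkM hin.2.1 (fenceSet_subset (Tf.F_subset hvF))
      ⟨by omega, by omega, by omega, by omega⟩⟩
    rw [trapDomain_D]
    exact Finset.mem_coe.2 hin.1
  exact ⟨x', hx'O, hpath.mono hsub⟩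

/-- **The fence of the term of a rerouted member attaches to the member.** With `Tf` a fence of
the `u`-th term stopped at the term and `u` the term chosen for the member `A` (start `a`), the
attachment site `Tf.q ∈ c` lies in `τ.reroute A a`: it is next to the right site `Tf.p`, hence
right of `τ` or the junction — or, if `Tf.p` is exterior, it is the tip. [cite: KestenSidoraviciusZhang1998, App. §7 (7.9) p. 27] -/
theorem termFence_q_mem_reroute (hu : (trapDomain M).lowestSeq ω u = some (c, z)) (hraw : TrapRawOK M c z k ω)
    (hk : 1 ≤ k) (hkM : 31 * (k : ℤ) + 1 ≤ M) (hz8 : -(2 * (M : ℤ)) + 8 * k < z 1 ∧ z 1 + 8 * k < 0)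
    (Tf : TermFence M c z k ω ↑c) {A : Set (Site 2)} {a : Site 2} (hft : τ.firstTerm A a = some u) :
    Tf.q ∈ τ.reroute A a := by
  have hcut := trapDomain_cutProp M
  have hc := (JDomain.isCrossing_of_lowestSeq hu).1
  have hk' : (1 : ℤ) ≤ k := by exact_mod_cast hk
  have hq : Tf.q ∈ c := Finset.mem_coe.1 Tf.q_mem
  by_cases hpn : triNorm Tf.p ≤ 2 * M
  · obtain ⟨j, hj, hpj⟩ := τ.isRight_of_mem_termFence hu hraw hk hkM hz8 Tf Tf.p_mem hpn
    by_cases hqT : Tf.q ∈ τ.T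
    · rw [τ.eq_jn_of_mem_term hcut hu hq hqT]
      exact jn_mem_reroute hft
    · have hqD : Tf.q ∈ ((↑(trapDomain M).D : Set (Site 2)) \ τ.T) :=
        ⟨by rw [trapDomain_D]; exact Finset.mem_coe.2 (hc.subset hq), hqT⟩
      exact mem_reroute_of_isRight hft hu hq ⟨j, hj, (PathIn.of_adj hqD hpj.left_mem Tf.adj).trans hpj⟩
  · push Not at hpn
    have hqT : Tf.q ∈ trapD M := hc.subset hq
    have hqb : triNorm Tf.q = 2 * M := triNorm_eq_of_adj_exterior hqT hpn Tf.adj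
    have hbx := fenceSet_box (Tf.F_subset Tf.p_mem)
    have hadj1 := triGraph_adj_coord Tf.adj 1
    have hqO : Tf.q ∈ trapO M := mem_trapO_of_near_tip hqT hqb (tip_mem_trapO hc) hz8 hk ⟨by omega, by omega⟩
    rw [hc.eq_tip _ hq hqO]
    exact tip_mem_reroute hcut hft hu

/-- **The fence misses its own member**: inside fence sites are right of `τ`, the first part of the
member is left of `τ` (members inside `Λ_{2M}`, start in `Λ_M`), and the tail lies on the term,
which the fence avoids. [cite: KestenSidoraviciusZhang1998, App. §7 (7.9) p. 27] -/
theorem not_mem_reroute_of_mem_termFence (hu : (trapDomain M).lowestSeq ω u = some (c, z))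
    (hraw : TrapRawOK M c z k ω) (hk : 1 ≤ k) (hkM : 31 * (k : ℤ) + 1 ≤ M)
    (hz8 : -(2 * (M : ℤ)) + 8 * k < z 1 ∧ z 1 + 8 * k < 0) (Tf : TermFence M c z k ω ↑c)
    {A : Set (Site 2)} {a : Site 2} (hft : τ.firstTerm A a = some u) (hAn : ∀ v ∈ A, triNorm v ≤ 2 * M)
    (han : triNorm a ≤ M) {x : Site 2} (hxF : x ∈ Tf.F) : x ∉ τ.reroute A a := by
  intro hxr
  have hcut := trapDomain_cutProp M
  rcases (mem_reroute_iff hft).1 hxr with hxc | hxt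
  · have hxn := hAn x (comp_subset hxc)
    have hxD : x ∈ (trapDomain M).D := (mem_fenceSet_inside (Tf.F_subset hxF) hxn).1
    have hl := isLeft_of_mem_comp (not_mem_trapDomain_D_of_triNorm_le han) (trapDomain_entry hAn) hxc hxD
    exact τ.not_isRight_of_isLeft hcut hl (τ.isRight_of_mem_termFence hu hraw hk hkM hz8 Tf hxF hxn)
  · exact fenceSet_disjoint (Tf.F_subset hxF) (tail_subset_term hu hxt)

/-- **No invasion of fence zones.** Let the `u`-th term `c` (tip `z`, `8k`-middle) be raw-good at
scale `k` (`32k + 1 ≤ M`), `Tf` a fence of `c` stopped at `c`, `u` the term of the member `A`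
(start `a`), and `R'` any open set of sites of `Λ_{2M}`, `𝕋`-connected from a site `a'` of
`Λ_M`, disjoint from `τ.reroute A a` (e.g. any other member of the final family). Then `R'` misses
the connection `Tf.F`. Proof: an inside fence site `x ∈ R'` is right of `τ`; follow `R'` from `x`
towards `a'`: by the inner ring the path enters `lower c z`, first at a site `q` of `c` next to a
site `p` of `above c z`, through open sites of `above c z` in the `7k`-box, which are off `T`
(`not_mem_T_near_tip`); so `p` is right of `τ`, hence `q` is right of `τ` or the junction, ie
`q ∈ τ.reroute A a` — but `q ∈ R'`. [cite: KestenSidoraviciusZhang1998, App. §7 (7.9) p. 27] -/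
theorem not_mem_of_mem_termFence (hu : (trapDomain M).lowestSeq ω u = some (c, z)) (hraw : TrapRawOK M c z k ω)
    (hk : 1 ≤ k) (hkM : 32 * (k : ℤ) + 1 ≤ M) (hz8 : -(2 * (M : ℤ)) + 8 * k < z 1 ∧ z 1 + 8 * k < 0)
    (Tf : TermFence M c z k ω ↑c) {A : Set (Site 2)} {a : Site 2} (hft : τ.firstTerm A a = some u)
    {R' : Set (Site 2)} (hR'ω : R' ⊆ ω) (hR'n : ∀ v ∈ R', triNorm v ≤ 2 * M) {a' : Site 2}
    (ha'n : triNorm a' ≤ M) (hconn' : ∀ x ∈ R', PathIn triGraph R' a' x)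
    (hdisj : Disjoint R' (τ.reroute A a)) {x : Site 2} (hxF : x ∈ Tf.F) : x ∉ R' := by
  intro hxR
  have hcut := trapDomain_cutProp M
  have hc := (JDomain.isCrossing_of_lowestSeq hu).1
  have hz := trapO_coord (tip_mem_trapO hc)
  have hk' : (1 : ℤ) ≤ k := by exact_mod_cast hk
  have hxn := hR'n x hxR
  have hxr : τ.IsRight x := τ.isRight_of_mem_termFence hu hraw hk (by omega) hz8 Tf hxF hxn
  have hxin := mem_fenceSet_inside (Tf.F_subset hxF) hxn
  have hxbox := fenceSet_box (Tf.F_subset hxF)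
  set L : Set (Site 2) := ((↑((trapDomain M).lower c z) : Set (Site 2)))ᶜ with hL
  have hxL : x ∈ L := fun h =>
    (JDomain.mem_lower_iff_not_mem_above (show x ∈ (trapDomain M).D from hxin.1)).1 (Finset.mem_coe.1 h) hxin.2.1
  have ha'0 : a' 0 ≤ z 0 - 7 * k := by
    have := le_trans (le_abs_self _) (abs_le_triNorm a').1
    omega
  rcases (hconn' x hxR).symm.exit_or (R := L) hxL with hp | ⟨p, q, hpL, hqL, hqR, hpq, hp⟩
  · exact hraw.inner_ring hk ⟨by omega, by omega, by omega, by omega⟩ (Or.inl ha'0)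
      (hp.mono fun v hv => ⟨hv.1, hR'ω hv.2⟩)
  · obtain ⟨S, hS, hSp, hSall⟩ := hp.exists_support
    have hSin : ∀ v ∈ S, v ∈ (trapDomain M).above c z ∧ v ∉ τ.T := by
      intro v hv
      have hvL : v ∈ L := (hS hv).1
      have hvR : v ∈ R' := (hS hv).2
      have hvω := hR'ω hvR
      have hvbox : ¬ (v 0 ≤ z 0 - 7 * k ∨ z 0 + 7 * k ≤ v 0 ∨ v 1 ≤ z 1 - 7 * k ∨ z 1 + 7 * k ≤ v 1) :=
        fun hout => hraw.inner_ring hk ⟨by omega, by omega, by omega, by omega⟩ hout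
          ((hSall v hv).mono fun w hw => ⟨(hS hw).1, hR'ω (hS hw).2⟩)
      push Not at hvbox
      have hvT : v ∈ trapD M := mem_trapD_of_triNorm_le (by omega) (hR'n v hvR)
      have hva : v ∈ (trapDomain M).above c z := by
        by_contra hva
        exact hvL (Finset.mem_coe.2 ((JDomain.mem_lower_iff_not_mem_above (show v ∈ (trapDomain M).D from hvT)).2 hva))
      exact ⟨hva, τ.not_mem_T_near_tip hu hraw hk (by omega) hva hvω ⟨by omega, by omega, by omega, by omega⟩⟩
    have hpath : PathIn triGraph ((↑(trapDomain M).D : Set (Site 2)) \ τ.T) x p :=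
      hSp.mono fun v hv => ⟨by rw [trapDomain_D]; exact Finset.mem_coe.2 (JDomain.above_subset_D (hSin v hv).1),
        (hSin v hv).2⟩
    have hpr : τ.IsRight p := τ.isRight_of_pathIn hpath.symm hxr
    have hpa : p ∈ (trapDomain M).above c z := (hSin p hSp.right_mem).1
    have hql : q ∈ (trapDomain M).lower c z := Finset.mem_coe.1 (not_not.1 hqL)
    have hqc : q ∈ c := by
      rcases JDomain.mem_lower.1 hql with h | h
      · exact h
      · exact absurd hpq (JDomain.not_adj_above_below hpa h)
    have hqmem : q ∈ τ.reroute A a := by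
      by_cases hqT : q ∈ τ.T
      · rw [τ.eq_jn_of_mem_term hcut hu hqc hqT]
        exact jn_mem_reroute hft
      · have hqD : q ∈ ((↑(trapDomain M).D : Set (Site 2)) \ τ.T) :=
          ⟨by rw [trapDomain_D]; exact Finset.mem_coe.2 (hc.subset hqc), hqT⟩
        exact mem_reroute_of_isRight hft hu hqc
          (τ.isRight_of_pathIn (PathIn.of_adj hqD hpath.right_mem hpq.symm) hpr)
    exact Set.disjoint_left.1 hdisj hqR hqmem

end JDomain.Transversal

/-- **Fences of two terms of one frame are disjoint, the higher more than `17k` rows up.** For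
`u < w` with the `u`-th term raw-good at scale `k` (`31k + 1 ≤ M`): the tip of the `w`-th term is
more than `17k` rows above (outer ring), so the exterior parts of the two connections occupy
disjoint rows, and the inside part of the lower connection does not enter `above c'`
(`TermFence.not_mem_above_of_row_lt`) where the inside part of the higher one lies. [cite: Nolin2008, §4.4 Lemma 15 (proof) (arXiv 0711.4948: Lemma 14)] -/
theorem termFence_disjoint_of_lt {u w k' : ℕ} {c c' : Finset (Site 2)} {z z' : Site 2} (huw : u < w)
    (hu : (trapDomain M).lowestSeq ω u = some (c, z)) (hw : (trapDomain M).lowestSeq ω w = some (c', z'))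
    (hraw : TrapRawOK M c z k ω) (hk : 1 ≤ k) (hkM : 31 * (k : ℤ) + 1 ≤ M)
    (Tf : TermFence M c z k ω ↑c) (Tf' : TermFence M c' z' k' ω ↑c') :
    Disjoint Tf.F Tf'.F ∧ z 1 + 17 * k < z' 1 := by
  have hcut := trapDomain_cutProp M
  have hc := (JDomain.isCrossing_of_lowestSeq hu).1
  obtain ⟨hc', hc'ω⟩ := JDomain.isCrossing_of_lowestSeq hw
  have habove : c' ⊆ (trapDomain M).above c z := JDomain.lowestSeq_subset_above_of_lt hcut huw hu hw
  have hoff : ∀ v ∈ c', v ∉ (trapDomain M).lower c z := fun v hv hvl =>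
    (JDomain.mem_lower_iff_not_mem_above (hc'.subset hv)).1 hvl (habove hv)
  have hlt : z 1 < z' 1 := JDomain.ht_lowestSeq_lt_of_lt hcut huw hu hw
  have hgap : z 1 + 17 * k < z' 1 := hraw.row_gap hk hkM hc hc' hc'ω hoff hlt
  refine ⟨Set.disjoint_left.2 fun x hx hx' => ?_, hgap⟩
  by_cases hxn : triNorm x ≤ 2 * M
  · have hxa' : x ∈ (trapDomain M).above c' z' := (mem_fenceSet_inside (Tf'.F_subset hx') hxn).2.1
    have hdisj : ∀ v ∈ Tf.F, v ∉ c' := fun v hv =>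
      Tf.not_mem_of_offLower hraw hk (by omega) hc hc' hc'ω hoff hv
    exact Tf.not_mem_above_of_row_lt hk (tip_mem_trapO hc) hc' (by omega) hdisj hx hxn hxa'
  · push Not at hxn
    have h1 := mem_fenceSet_outside (Tf'.F_subset hx') hxn
    have h2 := (fenceSet_box (Tf.F_subset hx)).2.2.2
    omega

/-- The fence of a term misses every other term of its frame (earlier terms lie below, later ones
off `lower`, far by the inner ring; `7k + 1 ≤ M`). [cite: Nolin2008, §4.4 Lemma 15 (proof) (arXiv 0711.4948: Lemma 14)] -/
theorem termFence_not_mem_term {u w : ℕ} {c c' : Finset (Site 2)} {z z' : Site 2} (huw : u ≠ w)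
    (hu : (trapDomain M).lowestSeq ω u = some (c, z)) (hw : (trapDomain M).lowestSeq ω w = some (c', z'))
    (hraw : TrapRawOK M c z k ω) (hk : 1 ≤ k) (hkM : 7 * (k : ℤ) + 1 ≤ M)
    (Tf : TermFence M c z k ω ↑c) {x : Site 2} (hx : x ∈ Tf.F) : x ∉ c' := by
  have hcut := trapDomain_cutProp M
  have hc := (JDomain.isCrossing_of_lowestSeq hu).1
  rcases Nat.lt_or_gt_of_ne huw with hlt | hgt
  · obtain ⟨hc', hc'ω⟩ := JDomain.isCrossing_of_lowestSeq hw
    have habove : c' ⊆ (trapDomain M).above c z := JDomain.lowestSeq_subset_above_of_lt hcut hlt hu hw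
    have hoff : ∀ v ∈ c', v ∉ (trapDomain M).lower c z := fun v hv hvl =>
      (JDomain.mem_lower_iff_not_mem_above (hc'.subset hv)).1 hvl (habove hv)
    exact Tf.not_mem_of_offLower hraw hk hkM hc hc' hc'ω hoff hx
  · exact Tf.not_mem_of_subset_below (JDomain.lowestSeq_subset_below_of_lt hcut hgt hw hu) hx

end Literature.Probability.Percolation
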